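/-
COR-CM (cell pub-hodgecm2, stage 2 of the Hodge ladder) — junction B01 `PerLFace_of_PerL` (`CorCM/Interfaces.lean`:111), the
O-AS-TYPED lane of its leaf B01-O `Universe.FaceWedgeOverlap` (COORDINATOR RULING «FINISH-TODAY SWARM» 2026-08-21T16:13:55Z (3);
lead NAMING RULING HOME/INBOX l.4194 (3): writer of `CorCM/B01/FaceWedgeOverlap*.lean` = pub-hodgecm2-b01-x2; owner of B01 =
pub-hodgecm2-own-b01, who may fold).  Seat prover-pub-hodgecm2-b01-x2-0 (gen 1), 2026-08-21.  Theorems only: no `def`, no cite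
binder, nothing asserted, no `sorry`.  FRAMING (COORDINATOR RULING 2026-08-21T11:55:35Z): HC_CM is NOT proved; B01 is NOT proved.
-/
import Summits.HodgeConjecture.CorCM.B01.Transposition.Item6HoldsRec
import HarnessLib

/-!
# B01 BY NAME from B01-S and the dictionary-with-coupling clause `hD` — the leaf B01-O BYPASSED

The B01 row of record reads `PerLFace_of_PerL ⇐ (∀ data, FaceSupply) ∧ (∀ data, FaceWedgeOverlap)`
(`Model.perLFace_of_PerL_of_supply_heckeWedge10_overlap`, `B01/FaceInputsSplit.lean`:236, with B01-H the tree theorem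
`Transposition.Model.heckeWedge10_of_heckeFamily`, `Transposition/Item6HeckeFamily.lean`:294).  Its second leaf B01-O
(`Universe.FaceWedgeOverlap`, :101) is a finite-level INTERSECTION statement for EVERY (12)-wedge, which exceeds the live target
of the transposition lane — the `L²`/closure clause `hD` (item (iii) dictionary `HG, emb, cover, emb_cover, inner_emb` + item (v)
saturated coupling «every (12)-wedge-function of `U_{ψ₀}`/`U_{ψ₁}`-classes lies in the closed span of the (34)-wedge-functions
of `U_{ψ₂}`/`U_{ψ₃}`-classes», verbatim the hypothesis `hD` of `Model.faceThetaDataExists_of_supply_of_dictionary` /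
`Model.hc_cm_of_supply_of_dictionary_of_eq`, `Transposition/Item6HoldsRec.lean`:157–175 / :211–224) — by exactly one
finite-level-descent conjunct (`CorCM/B01/FaceWedgeOverlapDescent.lean`, p290964: B01-O ⇐ `hD` ∧ LEVEL DESCENT).

THIS FILE records that the B01 ROW ITSELF needs neither B01-O nor level descent: **`PerLFace_of_PerL` ⇐ B01-S ∧ `hD` BY
NAME**, because the engine consumes only a PAIRING (`Universe.periodNV_of_faceThetaDatum`, `B01/ThetaRealisationSocket.lean`:106)
and the ∀ι₁ ∀V shape of `PerLFace = PeriodThmF` is matched by the ∀ι₁ ∀V shapes of B01-S and `hD`: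

* `Model.nonempty_faceThetaDatum_of_supply_dictionary` — on `picardCMUniverse hHD hI h₁ h₃`, at EVERY `(F, f, ι₁, V)`: B01-S at
  that context (two non-zero classes of `U_{ψ₀}(Γ)`, `U_{ψ₁}(Γ)`) and `hD` at that context give a socket datum
  `FaceThetaDatum ι₁ V F f.psi ι₁` — the SATURATED datum `Transposition.FaceThetaSupply.ofUiso` (`Item6Holds.lean`:119) with
  Prop 4.3 from B01-H (`FaceThetaSupply.wedge_ofUiso`, :138), `lineField` by Hodge–Riemann (2,0) (`lineField_of_wedge`,
  `Item6SupplyAssembly.lean`:219; `universeOf_hodgeRiemann_pms`), the coupling and the dictionary from `hD`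
  (`FaceThetaSupply.toFaceThetaDatum`, :239).  This is the per-context (∀ι₁ ∀V) twin of
  `Model.faceThetaDataExists_of_supply_of_dictionary` (∃ι₁ ∃V).
* `Model.perLFace_of_PerL_of_supply_dictionary` — **B01 BY NAME**: `(∀ data, FaceSupply) → (∀ data, hD) → PerLFace_of_PerL`
  (`Model.perLFace_of_PerL_of_faceThetaData`, `ThetaRealisationSocket.lean`:200); `U.PerL` idle.
* `Model.perLFace_of_supply_dictionary_of_eq` — the closed instance, legible form (`hU : U = U_rec`, by `rfl`): B01-S and `hD`
  on `U` give `U.PerLFace` (= F3's hypothesis on the universe OF RECORD).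

READING FOR THE B01 ROW (own-b01 decides; this file only supplies the term): the row «B01 ⇐ B01-S ∧ B01-O» may be re-cut as
«B01 ⇐ B01-S ∧ hD» with NO loss toward `HC_CM` and NO finite-level descent; B01-O then leaves the critical path (it remains a
displayed strengthening, = `hD` ∧ LEVEL DESCENT by p290964).  The open content is unchanged and is `hD` (items (iii)+(v) at
`Θ := Uiso`, including theta-exhaustion; red-team TGTBT DELTA 1 rows 14–15) together with B01-S.  HC_CM is NOT proved; B01 is NOT
proved: neither `hS` nor `hD` is inhabited by anyone.
-/

noncomputable section

open scoped TensorProduct InnerProductSpace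

namespace Summit.HodgeConjecture.CorCM

namespace Model

open Literature.AlgebraicGeometry.Motives (CMType HodgeStructure)
open Literature.AlgebraicGeometry.Motives.HodgeStructure (conj)
open Literature.NumberTheory.Automorphic
open Literature.NumberTheory.Automorphic.PicardCM
open Literature.AlgebraicGeometry.HodgeTheory

/-- **Socket data at EVERY face context from B01-S and `hD` there** (model universe `picardCMUniverse hHD hI h₁ h₃`): the
saturated theta sets `Θ i Γ := U_{ψ i}(Γ)_{ι₁}` (`Transposition.FaceThetaSupply.ofUiso`), Prop 4.3 for them from the tree theorem
B01-H (`Transposition.Model.heckeWedge10_of_heckeFamily`, `FaceThetaSupply.wedge_ofUiso`), `lineField` by Hodge–Riemann (2,0)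
(`lineField_of_wedge`, `universeOf_hodgeRiemann_pms`), coupling + dictionary = `hD` (`FaceThetaSupply.toFaceThetaDatum`).
Displayed binders: `hS` (B01-S at this context) and `hD` (at this context); nothing else. [folklore] -/
theorem nonempty_faceThetaDatum_of_supply_dictionary (hHD : exists_isReal_hodgeModel)
    (hI : hodgePQ_independent_of_hodgeModel) (h₁ : BallQuotientUniformised) (h₃ : CMAbelianVarietyRealised)
    {F : CMField} (f : Face F) (ι₁ : F →+* ℂ) (V : HermSpace3 F ι₁)
    (hS : ∃ (Γ : Level V) (ω₀ ω₁ : (picardCMUniverse hHD hI h₁ h₃).CohC ((picardCMUniverse hHD hI h₁ h₃).pms F ι₁ V Γ) 1),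
      ω₀ ∈ (picardCMUniverse hHD hI h₁ h₃).Uiso Γ F (f.psi 0) ι₁ ∧ ω₁ ∈ (picardCMUniverse hHD hI h₁ h₃).Uiso Γ F (f.psi 1) ι₁ ∧
        ω₀ ≠ 0 ∧ ω₁ ≠ 0)
    (hD : ∃ (HG : Type) (_ : NormedAddCommGroup HG) (_ : InnerProductSpace ℂ HG)
        (emb : ∀ Γ : Level V, (picardCMUniverse hHD hI h₁ h₃).CohC ((picardCMUniverse hHD hI h₁ h₃).pms F ι₁ V Γ) 2 →ₗ[ℂ] HG)
        (cover : ∀ (Γ Γ' : Level V), Γ' ≤ Γ →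
          (picardCMUniverse hHD hI h₁ h₃).Mor ((picardCMUniverse hHD hI h₁ h₃).pms F ι₁ V Γ')
            ((picardCMUniverse hHD hI h₁ h₃).pms F ι₁ V Γ)),
        (∀ (Γ : Level V) (ω₁ ω₂ : (picardCMUniverse hHD hI h₁ h₃).CohC ((picardCMUniverse hHD hI h₁ h₃).pms F ι₁ V Γ) 1),
          ω₁ ∈ (picardCMUniverse hHD hI h₁ h₃).Uiso Γ F (f.psi 0) ι₁ →
          ω₂ ∈ (picardCMUniverse hHD hI h₁ h₃).Uiso Γ F (f.psi 1) ι₁ →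
          emb Γ ((picardCMUniverse hHD hI h₁ h₃).cup2C ((picardCMUniverse hHD hI h₁ h₃).pms F ι₁ V Γ) 1 ω₁ ω₂) ∈
            (Submodule.span ℂ {x : HG | ∃ (Γ' : Level V), ∃ ω₃ ∈ (picardCMUniverse hHD hI h₁ h₃).Uiso Γ' F (f.psi 2) ι₁,
              ∃ ω₄ ∈ (picardCMUniverse hHD hI h₁ h₃).Uiso Γ' F (f.psi 3) ι₁,
              x = emb Γ' ((picardCMUniverse hHD hI h₁ h₃).cup2C ((picardCMUniverse hHD hI h₁ h₃).pms F ι₁ V Γ') 1 ω₃ ω₄)}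
              ).topologicalClosure) ∧
        (∀ (Γ Γ' : Level V) (hle : Γ' ≤ Γ)
          (x : (picardCMUniverse hHD hI h₁ h₃).CohC ((picardCMUniverse hHD hI h₁ h₃).pms F ι₁ V Γ) 2),
          emb Γ' ((picardCMUniverse hHD hI h₁ h₃).pullC (cover Γ Γ' hle) 2 x) = emb Γ x) ∧
        (∀ Γ : Level V, ∃ c : ℂ, c ≠ 0 ∧
          ∀ x y : (picardCMUniverse hHD hI h₁ h₃).CohC ((picardCMUniverse hHD hI h₁ h₃).pms F ι₁ V Γ) 2,
          x ∈ ((picardCMUniverse hHD hI h₁ h₃).hodge ((picardCMUniverse hHD hI h₁ h₃).pms F ι₁ V Γ) 2).F 2 →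
          y ∈ ((picardCMUniverse hHD hI h₁ h₃).hodge ((picardCMUniverse hHD hI h₁ h₃).pms F ι₁ V Γ) 2).F 2 →
            ⟪emb Γ y, emb Γ x⟫_ℂ = c * (picardCMUniverse hHD hI h₁ h₃).trC ((picardCMUniverse hHD hI h₁ h₃).pms F ι₁ V Γ) 4
              ((picardCMUniverse hHD hI h₁ h₃).cup2C ((picardCMUniverse hHD hI h₁ h₃).pms F ι₁ V Γ) 2 x (conj y)))) :
    Nonempty ((picardCMUniverse hHD hI h₁ h₃).FaceThetaDatum ι₁ V F f.psi ι₁) := by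
  obtain ⟨Γ, ω₀, ω₁, h₀, h₁', hne₀, hne₁⟩ := hS
  obtain ⟨HG, _, _, emb, cover, hiso, hcov, hinner⟩ := hD
  have hsup : ∃ Γ : Level V, (∃ ω₀ ∈ (picardCMUniverse hHD hI h₁ h₃).Uiso Γ F (f.psi 0) ι₁, ω₀ ≠ 0) ∧
      (∃ ω₁ ∈ (picardCMUniverse hHD hI h₁ h₃).Uiso Γ F (f.psi 1) ι₁, ω₁ ≠ 0) :=
    ⟨Γ, ⟨ω₀, h₀, hne₀⟩, ⟨ω₁, h₁', hne₁⟩⟩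
  let S : Transposition.FaceThetaSupply (picardCMUniverse hHD hI h₁ h₃) ι₁ V F f.psi ι₁ :=
    Transposition.FaceThetaSupply.ofUiso (picardCMUniverse hHD hI h₁ h₃) F f.psi ι₁ hsup
  have hw : S.Wedge :=
    Transposition.FaceThetaSupply.wedge_ofUiso
      (universeOf_fact_pull_comp hHD hI (ballQuotientUniformisedDatum_of h₁) h₃)
      (universeOf_fact_pull_hodge hHD hI (ballQuotientUniformisedDatum_of h₁) h₃)
      (Transposition.Model.heckeWedge10_of_heckeFamily hHD hI h₁ h₃) F f.psi ι₁ hsup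
  exact ⟨S.toFaceThetaDatum HG emb
    (S.lineField_of_wedge (universeOf_fact_pull_hodge hHD hI (ballQuotientUniformisedDatum_of h₁) h₃)
      (universeOf_fact_cup2_hodge hHD hI (ballQuotientUniformisedDatum_of h₁) h₃) emb hinner
      (fun Γ η hη h0 => universeOf_hodgeRiemann_pms hHD hI (ballQuotientUniformisedDatum_of h₁) h₃ V Γ η hη h0) hw)
    hiso cover hcov hinner⟩

/-- **Binder B01 BY NAME from B01-S and `hD`, the leaf B01-O bypassed**: at every instance of the model universe, B01-S
(`Universe.FaceSupply`, `B01/FaceInputsSplit.lean`:50) and the dictionary-with-saturated-coupling clause `hD` (verbatim the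
hypothesis of `Model.faceThetaDataExists_of_supply_of_dictionary`, `Transposition/Item6HoldsRec.lean`:157–175, ∀ι₁ ∀V) give
`PerLFace_of_PerL` (`CorCM/Interfaces.lean`:111) through `Model.perLFace_of_PerL_of_faceThetaData`
(`B01/ThetaRealisationSocket.lean`:200).  No `FaceWedgeOverlap`, no finite-level descent; `U.PerL` idle.  B01 is NOT proved:
neither `hS` nor `hD` is inhabited. [folklore] -/
theorem perLFace_of_PerL_of_supply_dictionary
    (hS : ∀ (hHD : exists_isReal_hodgeModel) (hI : hodgePQ_independent_of_hodgeModel)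
      (h₁ : BallQuotientUniformised) (h₃ : CMAbelianVarietyRealised), (picardCMUniverse hHD hI h₁ h₃).FaceSupply)
    (hD : ∀ (hHD : exists_isReal_hodgeModel) (hI : hodgePQ_independent_of_hodgeModel)
      (h₁ : BallQuotientUniformised) (h₃ : CMAbelianVarietyRealised),
      ∀ (F : CMField), IsGalois ℚ F → 6 ≤ Module.finrank ℚ F → ∀ (f : Face F) (ι₁ : F →+* ℂ), f.Admissible ι₁ →
      ∀ V : HermSpace3 F ι₁,
        ∃ (HG : Type) (_ : NormedAddCommGroup HG) (_ : InnerProductSpace ℂ HG)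
          (emb : ∀ Γ : Level V, (picardCMUniverse hHD hI h₁ h₃).CohC ((picardCMUniverse hHD hI h₁ h₃).pms F ι₁ V Γ) 2 →ₗ[ℂ] HG)
          (cover : ∀ (Γ Γ' : Level V), Γ' ≤ Γ →
            (picardCMUniverse hHD hI h₁ h₃).Mor ((picardCMUniverse hHD hI h₁ h₃).pms F ι₁ V Γ')
              ((picardCMUniverse hHD hI h₁ h₃).pms F ι₁ V Γ)),
          (∀ (Γ : Level V) (ω₁ ω₂ : (picardCMUniverse hHD hI h₁ h₃).CohC ((picardCMUniverse hHD hI h₁ h₃).pms F ι₁ V Γ) 1),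
            ω₁ ∈ (picardCMUniverse hHD hI h₁ h₃).Uiso Γ F (f.psi 0) ι₁ →
            ω₂ ∈ (picardCMUniverse hHD hI h₁ h₃).Uiso Γ F (f.psi 1) ι₁ →
            emb Γ ((picardCMUniverse hHD hI h₁ h₃).cup2C ((picardCMUniverse hHD hI h₁ h₃).pms F ι₁ V Γ) 1 ω₁ ω₂) ∈
              (Submodule.span ℂ {x : HG | ∃ (Γ' : Level V), ∃ ω₃ ∈ (picardCMUniverse hHD hI h₁ h₃).Uiso Γ' F (f.psi 2) ι₁,
                ∃ ω₄ ∈ (picardCMUniverse hHD hI h₁ h₃).Uiso Γ' F (f.psi 3) ι₁,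
                x = emb Γ' ((picardCMUniverse hHD hI h₁ h₃).cup2C ((picardCMUniverse hHD hI h₁ h₃).pms F ι₁ V Γ') 1 ω₃ ω₄)}
                ).topologicalClosure) ∧
          (∀ (Γ Γ' : Level V) (hle : Γ' ≤ Γ)
            (x : (picardCMUniverse hHD hI h₁ h₃).CohC ((picardCMUniverse hHD hI h₁ h₃).pms F ι₁ V Γ) 2),
            emb Γ' ((picardCMUniverse hHD hI h₁ h₃).pullC (cover Γ Γ' hle) 2 x) = emb Γ x) ∧
          (∀ Γ : Level V, ∃ c : ℂ, c ≠ 0 ∧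
            ∀ x y : (picardCMUniverse hHD hI h₁ h₃).CohC ((picardCMUniverse hHD hI h₁ h₃).pms F ι₁ V Γ) 2,
            x ∈ ((picardCMUniverse hHD hI h₁ h₃).hodge ((picardCMUniverse hHD hI h₁ h₃).pms F ι₁ V Γ) 2).F 2 →
            y ∈ ((picardCMUniverse hHD hI h₁ h₃).hodge ((picardCMUniverse hHD hI h₁ h₃).pms F ι₁ V Γ) 2).F 2 →
              ⟪emb Γ y, emb Γ x⟫_ℂ = c * (picardCMUniverse hHD hI h₁ h₃).trC ((picardCMUniverse hHD hI h₁ h₃).pms F ι₁ V Γ) 4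
                ((picardCMUniverse hHD hI h₁ h₃).cup2C ((picardCMUniverse hHD hI h₁ h₃).pms F ι₁ V Γ) 2 x (conj y)))) :
    PerLFace_of_PerL :=
  perLFace_of_PerL_of_faceThetaData fun hHD hI h₁ h₃ F hG h6 f ι₁ hι V =>
    nonempty_faceThetaDatum_of_supply_dictionary hHD hI h₁ h₃ f ι₁ V (hS hHD hI h₁ h₃ F hG h6 f ι₁ hι V)
      (hD hHD hI h₁ h₃ F hG h6 f ι₁ hι V)

/-- **The closed instance, legible form**: for a universe `U` together with the equation `hU : U = U_rec` (instantiate with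
`rfl`; `U_rec` = the model universe OF RECORD over `exists_isReal_hodgeModel_holds`, `hodgePQ_independent_of_hodgeModel_holds`,
`BallQuotient.ballQuotientUniformised_holds`, `cmAbelianVarietyRealised_holds`), B01-S on `U` and `hD` on `U` give `U.PerLFace` —
literally the hypothesis of the display `HC_CM_of_PerLFace` / F3.  Same shape as `Model.hc_cm_of_supply_of_dictionary_of_eq`
(`Item6HoldsRec.lean`:205) but with the ∀ι₁ ∀V supply (B01-S) and the conclusion `PerLFace` instead of `HC_CM`.  Nothing
inhabited. [folklore] -/
theorem perLFace_of_supply_dictionary_of_eq (U : Universe)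
    (hU : U = picardCMUniverse exists_isReal_hodgeModel_holds hodgePQ_independent_of_hodgeModel_holds
      BallQuotient.ballQuotientUniformised_holds cmAbelianVarietyRealised_holds)
    (hS : U.FaceSupply)
    (hD : ∀ (F : CMField), IsGalois ℚ F → 6 ≤ Module.finrank ℚ F → ∀ (f : Face F) (ι₁ : F →+* ℂ), f.Admissible ι₁ →
      ∀ V : HermSpace3 F ι₁,
        ∃ (HG : Type) (_ : NormedAddCommGroup HG) (_ : InnerProductSpace ℂ HG)
          (emb : ∀ Γ : Level V, U.CohC (U.pms F ι₁ V Γ) 2 →ₗ[ℂ] HG)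
          (cover : ∀ (Γ Γ' : Level V), Γ' ≤ Γ → U.Mor (U.pms F ι₁ V Γ') (U.pms F ι₁ V Γ)),
          (∀ (Γ : Level V) (ω₁ ω₂ : U.CohC (U.pms F ι₁ V Γ) 1), ω₁ ∈ U.Uiso Γ F (f.psi 0) ι₁ → ω₂ ∈ U.Uiso Γ F (f.psi 1) ι₁ →
            emb Γ (U.cup2C (U.pms F ι₁ V Γ) 1 ω₁ ω₂) ∈ (Submodule.span ℂ
              {x : HG | ∃ (Γ' : Level V), ∃ ω₃ ∈ U.Uiso Γ' F (f.psi 2) ι₁, ∃ ω₄ ∈ U.Uiso Γ' F (f.psi 3) ι₁,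
                x = emb Γ' (U.cup2C (U.pms F ι₁ V Γ') 1 ω₃ ω₄)}).topologicalClosure) ∧
          (∀ (Γ Γ' : Level V) (hle : Γ' ≤ Γ) (x : U.CohC (U.pms F ι₁ V Γ) 2),
            emb Γ' (U.pullC (cover Γ Γ' hle) 2 x) = emb Γ x) ∧
          (∀ Γ : Level V, ∃ c : ℂ, c ≠ 0 ∧ ∀ x y : U.CohC (U.pms F ι₁ V Γ) 2,
            x ∈ (U.hodge (U.pms F ι₁ V Γ) 2).F 2 → y ∈ (U.hodge (U.pms F ι₁ V Γ) 2).F 2 →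
              ⟪emb Γ y, emb Γ x⟫_ℂ = c * U.trC (U.pms F ι₁ V Γ) 4 (U.cup2C (U.pms F ι₁ V Γ) 2 x (conj y)))) :
    U.PerLFace := by
  subst hU
  exact Universe.periodThmF_of_faceThetaData (universeOf_fact_pull_comp _ _ _ _) (universeOf_fact_pull_hodge _ _ _ _)
    (universeOf_fact_cup2_hodge _ _ _ _) (universeOf_fact_pull_cup _ _ _ _)
    fun F hG h6 f ι₁ hι V =>
      nonempty_faceThetaDatum_of_supply_dictionary _ _ _ _ f ι₁ V (hS F hG h6 f ι₁ hι V) (hD F hG h6 f ι₁ hι V)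

end Model

end Summit.HodgeConjecture.CorCM

end
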